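import Summits.QuantumFields.YangMills.Theorems.FluctuationComparisonRegPrIntLS1aAlphaActivitySystem
import Summits.QuantumFields.YangMills.Theorems.FluctuationComparisonRegPrIntLS1aAlphaTwoSidedRep
import Summits.QuantumFields.YangMills.Theorems.FluctuationComparisonRegPrIntLS1aAlphaLocalCover
import Summits.QuantumFields.YangMills.Theorems.FluctuationComparisonRegPrIntLS1aAlphaFootDiam
import Literature.MathematicalPhysics.QuantumFieldTheory.Balaban1983to89.BalabanUVClass
import Literature.MathematicalPhysics.QuantumFieldTheory.Balaban1983to89.T3AlphaInputsACTwoRunLevel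
import HarnessLib

/-!
# S1a · UV3-NODE §69 — THE (m2) DOOR ASSEMBLED: «(α)-SOCKET ⟹ `BalabanUVClass.Mem`» AT ONE LEVEL OF ONE RUN, WITH EVERY GAP A NAMED, DISPLAYED HYPOTHESIS
# (the rc-0 skeleton of ★p1 «R3's UV-stability node typed with every gap named», in theorem form: the five row files COMPOSE)

Cell `ym3-torus` (YM ladder rung R3 = continuum `SU(2)` Yang–Mills on the three-torus — a RUNG: NOT d = 4, NOT infinite volume, NOT a mass gap, NOT Clay).
Width seat «width 8» `ym3-torus-px8` (gen 23), FREE px helper on crux `stmt-QuantumFields-20520`, count-neutral, DEFINITION-FREE, default heartbeats; the ASSEMBLY of the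
(m2) door «(α)-socket ⟹ `BalabanUVClass.Witness`» (px20 g20 §67.3 (m2), 09:06:17Z «GO — YOURS» to the px8 lineage; UV3-NODE §69.2's field map) from its landed rows:
✓p819182 `…S1aAlphaActivitySystem` (data, locality, gauge invariance, per-domain size, activity sum = `Pint`), ✓p820217 `…S1aAlphaTwoSidedRep` ((47′)∕(41′) in `Witness`
currency), ✓p821836 `…S1aAlphaLocalCover` (`cover`), ✓p821837 `…S1aAlphaFootDiam` (`diam_foot`) — and NOTHING ELSE: every remaining input is a DISPLAYED HYPOTHESIS with its
UV3-NODE name, so the theorem's binder list IS the gap list of the (α) ⟹ class-membership node, kernel-checked to be COMPLETE for `Mem` (the `Witness` is built).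

WHAT — ★★★ `mem_of_alphaRows` (run `K`, level `k ≤ K`, averaging of record `ℰp`): `BalabanUVClass.Mem (blockAvg ℰp) prm (fun W => e^{E_k}·ρ_k W)` for
`ρ_k := resDensity F γ K univ k` (the route's version of the level-`k` density of run `K`; the constant `E_k` of (41)∕(47) moved into the normalisation, as S1a's `∃ κ`
allows) with the EXPLICIT parameters `δ := θBal(K−k)` (the window of `AdmOnSmall`∕(47)), `β := β_K = (F.scheme ℰp γ).β K` (the RUN's coefficient — ★★OWNER RULING №80: this
is the honest currency; the height re-keying `β_K = β_j·L^{K−j}` is the (R-β1′) reading of `MemOfRun`, not this file's business), `κ := κ₁`, `M := 2r + 18M₁ + 3 + CD`,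
`Ccov := max C 0·θBal(K−k+1)²·(2·max C′ 0·(7 + 2r + 18M₁)³)`, `cE := 0` (`cst := 0`), `slack := Rm K k`, and the consumer's `δreg, δL, cLF, c5`, FROM:
* TYPED (α) schemas (lit `T3AlphaInputsAC(Schemas∕TwoRunLevel)`, hypotheses on a GIVEN `D`, never asserted): `IsLocal`, `GaugeInv26`, `TermSize`, `PintDecomp`, `AdmOnSmall`,
  `LocCover`, `EnlBounded` (+ `0 ≤ r`, `1 ≤ M₁`, `M₁ ∣ 2L^m`), `LocBlockVolume`, `Ineq41At`∕`Ineq47At` at `(K, k)` (POINTWISE — δ7: the package carries the a.e. forms; the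
  pointwise ones hold for px17's one version ✓p820698∕✓p821154), `MainTermIsAction`, `ChiRange`, `LFSum`;
* ROWS THE SOCKET LACKS, displayed (UV3-NODE §69.2∕§69.9, paste-ready there for the interface pen): (δ8) `hχ1` «χ = 1 on the window», (R0) `hR0`, (Z0) `hZ`, (δ1) `hBU`
  «`IsBlockUnion (M₁·L^i) Y`», (δ4) `hDiam` + `0 ≤ CD`, (X ⊂ X̃) `hsub` «`Y ⊆ enl K i Y`» (p.263), (δ11) `hGI` gauge invariance of `ρ_k`;
* (δ2-b) `hRegClass` — THE UNPRINTED G-K1a-1 STATEMENT (UV3-NODE l.426; RULING №82 (2) «displayed debt, never a fact»): the trivial-history minimiser is a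
  `Setup.IsBackground` over the ONE-clause class `{PlaqSmall δreg}` that `BalabanUVClass.Witness` v1.0–v1.1 pins; REMOVED by δ2-a — once the class file takes `reg` as a
  field (HOME `ym3-torus-px8/g23/delta2a/`), this binder is replaced by ✓`…S1aAlphaBackgroundClass.isBackground_regPr_window` with `reg := {RegPr F (K−k) K ε₀}` from
  `UminTrivIsRegMinimiser` ALONE (and THIS proof still compiles unchanged, the default class being the pinned one);
* THE LARGE-FIELD DEBT (δ9–δ10 + [Balaban1982Higgs2] §3.C; px10 g19 §45), as the two clauses `hlfle`, `hlarge` in `Witness` shape for THIS `lf := e^{E_k}·e^{−E_k+Rm_k}·(up − low)`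
  (= (41)'s non-trivial histories) and THIS density.

So the (α) ⟹ class-membership node of rung R3's UV-stability step is typed with EVERY gap a NAMED binder: eight socket rows (five XS interface rows + δ11 + δ2-b + X ⊂ X̃), the
LF lane's two clauses, and nothing hidden.  The numbering of the domains is `Finset.equivFin` of the tagged index `⟨i, Y⟩` exactly as in ✓p819182, so `cover`∕`diam_foot`
∕`act_bound`∕`eff` all read the SAME data.

WHAT THIS FILE IS NOT: a discharge of any binder; a `MemOfRun`∕`MemAtHeight` statement (height currency = (R-β1′)); S1a(ᴴ)'s (m) conjunct ((m) AS TYPED misstated by currency,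
RULING №80; AS PRINTED open); nothing of Bałaban's is asserted or proved; crux 20520, 19936, 19200 and `YM3TorusSU2` are NOT proved; no registered stub is closed; rung R3 =
SU(2) YM₃ on T³ — NOT d = 4, NOT infinite volume, NOT a mass gap, NOT Clay.  Sorry-free, axioms standard.

References: T. Bałaban, CMP **102** (1985) 255–275 [Balaban1985UV3] ((24)–(26) pp.262–263, (41)–(47) pp.266–267, (65)–(71) p.273); CMP **102** (1985) 277–309
[Balaban1985Variational] (Thm 1 p.279).
-/

set_option autoImplicit false

noncomputable section

namespace Summit.QuantumFields.YangMills.Theorems.FluctuationComparisonRegPrIntLS1aAlphaMemOfRows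

open Finset MeasureTheory
open scoped BigOperators
open Literature.MathematicalPhysics.QuantumFieldTheory.Balaban1983to89
open T3ContinuumYM3Torus T3UnitScaleTilt T3UnitLawDensityEML T3RestrictedUnitDensity T3AlphaInputsAC T3AlphaInputsACSchemas BalabanUVClass
open T3AlphaInputsACTwoRunLevel (LocBlockVolume)
open B10Eq42TorusConstraint (bondsIn mem_bondsIn_iff)
open B10Eq38TorusDomains (IsBlockUnion bdist)
open B5Eq118OneStroke (iterBlockOf)
open Summit.QuantumFields.YangMills.Theorems.FluctuationComparisonRegPrIntLS1aAlphaActivitySystem (sum_equivFin_symm_eq)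
open Summit.QuantumFields.YangMills.Theorems.FluctuationComparisonRegPrIntLS1aAlphaTwoSidedRep (lower_of_ineq47 upper_of_ineq41)
open Summit.QuantumFields.YangMills.Theorems.FluctuationComparisonRegPrIntLS1aAlphaLocalCover (coverShape_of_alpha)
open Summit.QuantumFields.YangMills.Theorems.FluctuationComparisonRegPrIntLS1aAlphaFootDiam (diamFoot_le)

variable {F : T3Family} {γ : ℝ}

open Classical in
/-- ★★★ **THE (m2) DOOR, ASSEMBLED** (run `K`, level `k ≤ K`, averaging of record `ℰp`, density `e^{E_k}·ρ_k` with `ρ_k := resDensity F γ K univ k` — the constant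
`E_k` of (41)∕(47) moved into the normalisation, as S1a's `∃ κ` allows): from the (α)-socket's TYPED schemas at the trivial history — `IsLocal`, `GaugeInv26`, `TermSize`,
`PintDecomp`, `AdmOnSmall`, `LocCover`, `EnlBounded`, `LocBlockVolume`, `Ineq41At`∕`Ineq47At` (pointwise), `MainTermIsAction`, `ChiRange`, `LFSum` — PLUS the named rows
the socket does not (yet) have, EACH A DISPLAYED HYPOTHESIS: (δ8) `hχ1` χ = 1 on the window, (R0) `hR0`, (Z0) `hZ`, (δ1) `hBU` block structure, (δ4) `hDiam` + `hCD`,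
(X ⊂ X̃) `hsub`, (δ11) `hGI` gauge invariance of `ρ_k`, (δ2-b) `hRegClass` — THE UNPRINTED G-K1a-1 statement «the trivial-history minimiser is a `Setup.IsBackground` over the
ONE-clause class `{PlaqSmall δreg}`» (UV3-NODE l.426; removed by δ2-a ∕ ✓`…S1aAlphaBackgroundClass` once the class file takes `reg := {RegPr}`, RULING №82), and the
LARGE-FIELD debt (δ9–δ10 + [B82] §3.C) as the two clauses `hlfle`, `hlarge` in `Witness` shape — the density is a MEMBER OF BAŁABAN's CLASS at level `k` of run `K`
with the EXPLICIT parameters `δ := θBal(K−k)`, `β := β_K = (F.scheme ℰp γ).β K`, `κ := κ₁`, `M := 2r + 18M₁ + 3 + CD`, `Ccov := max C 0·θBal(K−k+1)²·(2·max C′ 0·(7+2r+18M₁)³)`,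
`cE := 0`, `slack := Rm K k`, and the consumer's `δreg, δL, cLF, c5`.  Every `Witness` field is supplied BY NAME from ✓p819182 (activities), ✓p820217 (sandwich),
✓p821836 (cover), ✓p821837 (footprint diameter); the numbering of the domains is `Finset.equivFin` of the tagged index as in ✓p819182. [cite: Balaban1985UV3, (41)-(47) pp.266-267 and (24)-(26) pp.262-263] -/
theorem mem_of_alphaRows (D : AlphaDataT3 F γ) (Wd : LFData D) {b₀ p₀ C κ₁ C' r CD δreg δL cLF c5 : ℝ} {M₁ : ℕ} {K k : ℕ} (hk : k ≤ K)
    -- typed (α) schemas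
    (hloc : IsLocal D) (hgi : GaugeInv26 D) (hts : TermSize D b₀ p₀ C κ₁) (hdec : PintDecomp D) (hadm : AdmOnSmall D b₀ p₀)
    (hLC : LocCover D κ₁ C') (hEnl : EnlBounded D M₁ r) (hBV : LocBlockVolume D)
    (h41 : Ineq41At D K k) (h47 : Ineq47At D K k) (hM : MainTermIsAction D) (hχ : ChiRange D) (hLF : LFSum D Wd)
    (hr : 0 ≤ r) (hM1 : 1 ≤ M₁) (hMdvd : M₁ ∣ 2 * F.L ^ F.m) (hCD : 0 ≤ CD)
    -- rows the socket lacks (UV3-NODE §69.2 ∕ §69.9), displayed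
    (hχ1 : ∀ W : GaugeField (F.P K) k (Matrix.specialUnitaryGroup (Fin 2) ℂ), PlaqSmall (θBal F.L γ b₀ p₀ (K - k)) W → D.χ K k W = 1)
    (hR0 : ∀ (W : GaugeField (F.P K) k (Matrix.specialUnitaryGroup (Fin 2) ℂ)) v, Wd.wt K k (Wd.trivReg K k) v W = D.χ K k W)
    (hZ : D.Zterm K k (D.triv K k) = 0)
    (hBU : ∀ i, 1 ≤ i → i ≤ k → ∀ Y ∈ D.Loc K k (D.triv K k) i, IsBlockUnion (M₁ * F.L ^ i) Y)
    (hDiam : ∀ i, 1 ≤ i → i ≤ k → ∀ Y ∈ D.Loc K k (D.triv K k) i, ∀ x ∈ Y, ∀ y ∈ Y, bdist (F.P K) M₁ i x y ≤ CD * D.treeLen K i Y)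
    (hsub : ∀ K i (Y : Set (Site (F.P K) 0)), Y ⊆ D.enl K i Y)
    (hGI : GaugeField.GaugeInvariant (resDensity F γ K Set.univ k))
    -- δ2-b: UNPRINTED (UV3-NODE l.426 G-K1a-1); removed by δ2-a (RULING №82)
    (hRegClass : ∀ W : GaugeField (F.P K) k (Matrix.specialUnitaryGroup (Fin 2) ℂ), PlaqSmall (θBal F.L γ b₀ p₀ (K - k)) W →
      IsBackground (fun i => BlockAveraging.blockAvg (P := F.P K) (j := i) ℰp) {U | PlaqSmall δreg U} k W (D.Umin K k (D.triv K k) W))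
    -- the large-field debt (δ9–δ10 + [B82] §3.C), in `Witness` shape
    (hlfle : ∀ W : GaugeField (F.P K) k (Matrix.specialUnitaryGroup (Fin 2) ℂ),
      Real.exp (D.Ecst K k) * (Real.exp (-(D.Ecst K k) + D.Rm K k) * (D.up K k W - D.low K k W)) ≤
        Real.exp (-cLF) * Real.exp (c5 * Fintype.card (Site (F.P K) k)))
    (hlarge : ∀ (W : GaugeField (F.P K) k (Matrix.specialUnitaryGroup (Fin 2) ℂ)) (S : Finset (Plaq (F.P K) k)),
      (∀ p ∈ S, δL ≤ GaugeGroup.dist1 (GaugeField.plaqHol W p)) →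
        Real.exp (D.Ecst K k) * resDensity F γ K Set.univ k W ≤ Real.exp (-(cLF * S.card)) * Real.exp (c5 * Fintype.card (Site (F.P K) k))) :
    Mem (P := F.P K) (k := k) (fun i => BlockAveraging.blockAvg (P := F.P K) (j := i) ℰp)
      { δ := θBal F.L γ b₀ p₀ (K - k), δreg := δreg, δL := δL, β := (F.scheme ℰp γ).β K, κ := κ₁, M := 2 * r + 18 * M₁ + 3 + CD,
        Ccov := max C 0 * θBal F.L γ b₀ p₀ (K - k + 1) ^ 2 * (2 * max C' 0 * (7 + 2 * r + 18 * M₁) ^ 3), cE := 0, slack := D.Rm K k,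
        cLF := cLF, c5 := c5 }
      (fun W => Real.exp (D.Ecst K k) * resDensity F γ K Set.univ k W) := by
  classical
  -- the tagged domain index and its numbering (as ✓`activitySystem_of_alpha`)
  set s : Finset (Σ _ : ℕ, Set (Site (F.P K) 0)) := (Finset.Icc 1 k).sigma (fun i => D.Loc K k (D.triv K k) i) with hs
  set tag : Fin s.card → (Σ _ : ℕ, Set (Site (F.P K) 0)) := fun X => ((s.equivFin.symm X : s) : Σ _ : ℕ, Set (Site (F.P K) 0)) with htag
  have htag_mem : ∀ X, tag X ∈ s := fun X => (s.equivFin.symm X).2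
  have hlvl : ∀ X, 1 ≤ (tag X).1 ∧ (tag X).1 ≤ k ∧ (tag X).2 ∈ D.Loc K k (D.triv K k) (tag X).1 := fun X => by
    have h := htag_mem X
    rw [hs, Finset.mem_sigma, Finset.mem_Icc] at h
    exact ⟨h.1.1, h.1.2, h.2⟩
  -- constants
  have hL0 : (0 : ℝ) < F.L := by have := F.hL.2; exact_mod_cast (by omega : 0 < F.L)
  set θ := θBal F.L γ b₀ p₀ (K - k) with hθ
  set wt : Fin s.card → ℝ := fun X => max C 0 * θBal F.L γ b₀ p₀ (K - k + 1) ^ 2 * (((F.L : ℝ) ^ (k - (tag X).1))⁻¹) ^ 4 with hwt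
  have hwt0 : ∀ X, 0 ≤ wt X := fun X => by positivity
  -- the witness
  refine ⟨{
    bg := fun W => D.Umin K k (D.triv K k) W
    nDom := s.card
    supp := fun X => bondsIn 0 (D.enl K (tag X).1 (tag X).2)
    foot := fun X => Finset.univ.filter (fun y => ∃ z ∈ D.enl K (tag X).1 (tag X).2, iterBlockOf k z = y)
    len := fun X => D.treeLen K (tag X).1 (tag X).2
    wt := wt
    act := fun X => D.Pterm K (tag X).1 (tag X).2
    cst := 0
    lf := fun W => Real.exp (D.Ecst K k) * (Real.exp (-(D.Ecst K k) + D.Rm K k) * (D.up K k W - D.low K k W))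
    nonneg := fun W => mul_nonneg (Real.exp_nonneg _) (resDensity_nonneg F γ K Set.univ k W)
    measurable := (measurable_resDensity F γ K MeasurableSet.univ k).const_mul _
    gaugeInvariant := fun u W => by
      show Real.exp (D.Ecst K k) * resDensity F γ K Set.univ k (GaugeField.gaugeAct u W) = Real.exp (D.Ecst K k) * resDensity F γ K Set.univ k W
      rw [hGI u W]
    isBackground := hRegClass
    foot_nonempty := ?_
    supp_foot := ?_
    len_nonneg := fun X => hLC.1 K (tag X).1 (tag X).2
    wt_nonneg := hwt0
    diam_foot := ?_
    act_local := fun X U U' hUU' => hloc K (tag X).1 (tag X).2 U U' fun b hb => hUU' b hb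
    act_gaugeInvariant := fun X => hgi K (tag X).1 (tag X).2
    act_bound := ?_
    cover := ?_
    cst_abs_le := by simp
    lower := ?_
    upper := ?_
    lf_nonneg := fun W => mul_nonneg (Real.exp_nonneg _) (upper_of_ineq41 D Wd K k h41 hM hχ hLF hR0 hZ W).2
    lf_le := hlfle
    large := hlarge }⟩
  · -- foot_nonempty: `Y ≠ ∅` (block volume), `Y ⊆ X̃`
    intro X
    obtain ⟨z, hz⟩ := T3AlphaInputsACTwoRunLevel.LocBlockVolume.nonempty hBV (hlvl X).2.2
    exact ⟨iterBlockOf k z, Finset.mem_filter.mpr ⟨Finset.mem_univ _, z, hsub K _ _ hz, rfl⟩⟩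
  · -- supp_foot: a supporting bond starts inside `X̃`
    intro X b hb
    have h1 : b.src ∈ D.enl K (tag X).1 (tag X).2 := by
      have := (mem_bondsIn_iff.mp hb).1
      simpa using this
    exact Finset.mem_filter.mpr ⟨Finset.mem_univ _, b.src, h1, rfl⟩
  · -- diam_foot (✓p821837)
    intro X y hy y' hy'
    have hy1 := (Finset.mem_filter.mp hy).2
    have hy2 := (Finset.mem_filter.mp hy').2
    have h := diamFoot_le D hEnl hr hM1 hCD hLC.1 hk (hlvl X).2.1 (hDiam (tag X).1 (hlvl X).1 (hlvl X).2.1) (hlvl X).2.2 hy1 hy2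
    exact h
  · -- act_bound on the window (TermSize at the trivial history + AdmOnSmall)
    intro X W hW
    have hmem := hlvl X
    have hadm' : D.Adm K k (D.triv K k) W := hadm K k W hk hW
    have hsz := hts.2 K k (D.triv K k) W hk hadm' (tag X).1 hmem.1 hmem.2.1 (tag X).2 hmem.2.2
    refine hsz.trans ?_
    show C * Real.exp (-κ₁ * D.treeLen K (tag X).1 (tag X).2) * θBal F.L γ b₀ p₀ (K - k + 1) ^ 2 * (((F.L : ℝ) ^ (k - (tag X).1))⁻¹) ^ 4 ≤
      wt X * Real.exp (-(κ₁ * D.treeLen K (tag X).1 (tag X).2))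
    rw [hwt]
    have hexp : 0 ≤ Real.exp (-κ₁ * D.treeLen K (tag X).1 (tag X).2) := Real.exp_nonneg _
    have hθ2 : 0 ≤ θBal F.L γ b₀ p₀ (K - k + 1) ^ 2 := sq_nonneg _
    have hL4 : 0 ≤ (((F.L : ℝ) ^ (k - (tag X).1))⁻¹) ^ 4 := by positivity
    calc C * Real.exp (-κ₁ * D.treeLen K (tag X).1 (tag X).2) * θBal F.L γ b₀ p₀ (K - k + 1) ^ 2 * (((F.L : ℝ) ^ (k - (tag X).1))⁻¹) ^ 4
        ≤ max C 0 * Real.exp (-κ₁ * D.treeLen K (tag X).1 (tag X).2) * θBal F.L γ b₀ p₀ (K - k + 1) ^ 2 * (((F.L : ℝ) ^ (k - (tag X).1))⁻¹) ^ 4 := by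
          gcongr; exact le_max_left C 0
      _ = max C 0 * θBal F.L γ b₀ p₀ (K - k + 1) ^ 2 * (((F.L : ℝ) ^ (k - (tag X).1))⁻¹) ^ 4 * Real.exp (-(κ₁ * D.treeLen K (tag X).1 (tag X).2)) := by
          rw [neg_mul]; ring
  · -- cover (✓p821836), per footprint site
    intro y
    show ∑ X ∈ Finset.univ.filter (fun X => y ∈ Finset.univ.filter (fun y => ∃ z ∈ D.enl K (tag X).1 (tag X).2, iterBlockOf k z = y)),
        wt X * Real.exp (-(κ₁ * D.treeLen K (tag X).1 (tag X).2)) ≤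
      max C 0 * θBal F.L γ b₀ p₀ (K - k + 1) ^ 2 * (2 * max C' 0 * (7 + 2 * r + 18 * M₁) ^ 3)
    have hcnt := coverShape_of_alpha D hLC hEnl hr hM1 hMdvd hk hBU y
    -- rewrite the Fin-numbered filtered sum as the tagged filtered sum
    set g : (Σ _ : ℕ, Set (Site (F.P K) 0)) → ℝ := fun x =>
      if ∃ z ∈ D.enl K x.1 x.2, iterBlockOf k z = y then (((F.L : ℝ) ^ (k - x.1))⁻¹) ^ 4 * Real.exp (-κ₁ * D.treeLen K x.1 x.2) else 0 with hg
    have hsum : ∑ X ∈ Finset.univ.filter (fun X => y ∈ Finset.univ.filter (fun y => ∃ z ∈ D.enl K (tag X).1 (tag X).2, iterBlockOf k z = y)),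
          wt X * Real.exp (-(κ₁ * D.treeLen K (tag X).1 (tag X).2)) =
        max C 0 * θBal F.L γ b₀ p₀ (K - k + 1) ^ 2 * ∑ X : Fin s.card, g (tag X) := by
      rw [Finset.mul_sum, Finset.sum_filter]
      refine Finset.sum_congr rfl fun X _ => ?_
      simp only [Finset.mem_filter, Finset.mem_univ, true_and, hg, hwt]
      split_ifs with h
      · rw [neg_mul]; ring
      · ring
    rw [hsum]
    have hg' : ∑ X : Fin s.card, g (tag X) = ∑ x ∈ s, g x := sum_equivFin_symm_eq s g
    rw [hg', hs, ← Finset.sum_filter]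
    exact mul_le_mul_of_nonneg_left hcnt (by positivity)
  · -- lower (✓p820217's (47′) half, times `e^{E_k}`)
    intro W hW
    have hact : (∑ X : Fin s.card, D.Pterm K (tag X).1 (tag X).2 (D.Umin K k (D.triv K k) W)) = D.Pint K k (D.triv K k) W := by
      rw [hdec K k (D.triv K k) W]
      have h1 := sum_equivFin_symm_eq s (fun x => D.Pterm K x.1 x.2 (D.Umin K k (D.triv K k) W))
      change ∑ X : Fin s.card, D.Pterm K (tag X).1 (tag X).2 (D.Umin K k (D.triv K k) W) = _
      rw [h1, hs, Finset.sum_sigma]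
    have hlow := lower_of_ineq47 D K k h47 hM hχ1 W hW
    show Real.exp (-((F.scheme ℰp γ).β K * wilsonAction4 (D.Umin K k (D.triv K k) W)) +
        (∑ X : Fin s.card, D.Pterm K (tag X).1 (tag X).2 (D.Umin K k (D.triv K k) W)) + 0 - D.Rm K k) ≤
      Real.exp (D.Ecst K k) * resDensity F γ K Set.univ k W
    rw [hact]
    have hE : 0 < Real.exp (D.Ecst K k) := Real.exp_pos _
    calc Real.exp (-((F.scheme ℰp γ).β K * wilsonAction4 (D.Umin K k (D.triv K k) W)) + D.Pint K k (D.triv K k) W + 0 - D.Rm K k)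
        = Real.exp (D.Ecst K k) *
            Real.exp (-((F.scheme ℰp γ).β K * wilsonAction4 (D.Umin K k (D.triv K k) W)) + D.Pint K k (D.triv K k) W + (-D.Ecst K k) - D.Rm K k) := by
          rw [← Real.exp_add]; congr 1; ring
      _ ≤ Real.exp (D.Ecst K k) * resDensity F γ K Set.univ k W := mul_le_mul_of_nonneg_left hlow hE.le
  · -- upper (✓p820217's (41′) half, times `e^{E_k}`)
    intro W hW
    have hact : (∑ X : Fin s.card, D.Pterm K (tag X).1 (tag X).2 (D.Umin K k (D.triv K k) W)) = D.Pint K k (D.triv K k) W := by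
      rw [hdec K k (D.triv K k) W]
      have h1 := sum_equivFin_symm_eq s (fun x => D.Pterm K x.1 x.2 (D.Umin K k (D.triv K k) W))
      change ∑ X : Fin s.card, D.Pterm K (tag X).1 (tag X).2 (D.Umin K k (D.triv K k) W) = _
      rw [h1, hs, Finset.sum_sigma]
    have hup := (upper_of_ineq41 D Wd K k h41 hM hχ hLF hR0 hZ W).1
    show Real.exp (D.Ecst K k) * resDensity F γ K Set.univ k W ≤
      Real.exp (-((F.scheme ℰp γ).β K * wilsonAction4 (D.Umin K k (D.triv K k) W)) +
        (∑ X : Fin s.card, D.Pterm K (tag X).1 (tag X).2 (D.Umin K k (D.triv K k) W)) + 0 + D.Rm K k) +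
        Real.exp (D.Ecst K k) * (Real.exp (-(D.Ecst K k) + D.Rm K k) * (D.up K k W - D.low K k W))
    rw [hact]
    have hE : 0 < Real.exp (D.Ecst K k) := Real.exp_pos _
    calc Real.exp (D.Ecst K k) * resDensity F γ K Set.univ k W
        ≤ Real.exp (D.Ecst K k) *
            (Real.exp (-((F.scheme ℰp γ).β K * wilsonAction4 (D.Umin K k (D.triv K k) W)) + D.Pint K k (D.triv K k) W + (-D.Ecst K k) + D.Rm K k) +
              Real.exp (-(D.Ecst K k) + D.Rm K k) * (D.up K k W - D.low K k W)) := mul_le_mul_of_nonneg_left hup hE.le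
      _ = Real.exp (-((F.scheme ℰp γ).β K * wilsonAction4 (D.Umin K k (D.triv K k) W)) + D.Pint K k (D.triv K k) W + 0 + D.Rm K k) +
            Real.exp (D.Ecst K k) * (Real.exp (-(D.Ecst K k) + D.Rm K k) * (D.up K k W - D.low K k W)) := by
          rw [mul_add, ← Real.exp_add]; congr 2; ring

end Summit.QuantumFields.YangMills.Theorems.FluctuationComparisonRegPrIntLS1aAlphaMemOfRows

end
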